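import Summits.PneNP.PneNP.Theorems.SignDeg2AvoidAffineSplitMachine

/-!
# B4-FP, part 1/3: the rank-one-quadratic avoider as a machine, and its semantics on genuine codes

Cell pnp-ideate, ROUND-18 by-product B4 (`Theorems/RankOneQuadAvoid.lean`, pnp-ideate-p3: an explicit AVOID RULE
for outputs that are products of two affine forms over `𝔽₂`, `m ≥ 2n + 1`, by rank tests) — here turned into an
FP leaf of the range-avoidance ladder for `k`-local maps, every `k`.  The output class: tables
`P = c ⊕ (A ∧ B)` with `A`, `B` AFFINE (`SignDeg2Signing.IsAffinePred`) and a constant `c` (`IsRankOneQuad`: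
AND / OR / NAND / NOR of two parities of the read bits, and the affine tables themselves).  The machine
`r1Str k` (a program on lists; part 2: correctness via `RankOneQuadAvoid`; part 3: `CodeFP` typing and the leaf):

* decode (`LocalMapDecodeFP.decode`), read per output the FINITE table `r1Row k` (supports and constants of
  `A`, `B`, the outer constant `c`), form the two `𝔽₂`-rows `Σ_{i∈S} e_{v_{j,i}}` as index lists (`rcls`);
* INCONSISTENCY TEST of the affine system «`A_j = B_j = 1` for all `j`» by ONE span test over `n + 1`
  coordinates (`incons`: is `e_n` in the span of the augmented rows? — `Nc03Reduction.inSpan`);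
  if inconsistent print `(¬c_j)_j` (every product would have to be `1`);
* else find the first GOOD output `i` (both rows in the span of the OTHER outputs' rows: two span tests,
  `good`, `iStar`) and print `(¬c_j)_j` with bit `i` flipped (product `0` at `i`, `1` elsewhere).

Restricted-model algorithmic infrastructure; nothing here bears on `P` versus `NP`.
-/

set_option linter.dupNamespace false -- `Summit.PneNP.PneNP.…`: summit = sub-problem name (D-0017 single-conjunct layout)

namespace Summit.PneNP.PneNP.Theorems.RankOneQuadAvoidFP

open Literature.Computability.Complexity
open Summit.PneNP.PneNP.Theorems.SignDeg2Signing (IsAffinePred)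
open Summit.PneNP.PneNP.Theorems.LtfLocalAvoidFP (allBits mem_allBits tableOfBits tableOfBits_tabOf)
open Summit.PneNP.PneNP.Theorems.MajLocalAvoidFP (rowOf)
open Summit.PneNP.PneNP.Theorems.LocalMapDecodeFP (tabOf length_tabOf decode outsOf decode_encode hdrN hdrN_encode)
open Summit.PneNP.PneNP.Theorems.Nc03Reduction (inSpan)
open Summit.PneNP.PneNP.Theorems.AffineSplitFP (affData mapIdx_map_finRange getD_map_finRange)

variable {k n m : ℕ}

/-! ## The output class and its table data (the machine constant) -/

/-- `P` is a RANK-ONE QUADRATIC table: `P = c ⊕ (A ∧ B)` for affine `A`, `B` (`IsAffinePred`: parities of some of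
the read bits, possibly negated) and a constant bit `c` — over `𝔽₂`, `P = c + ℓ·ℓ'` for two affine forms.  Covers
AND / OR / NAND / NOR of two parities and (with `B ≡ 1`) the affine tables.  (An output CLASS posed by the
cell pnp-ideate, ROUND-18 §B4 — a predicate on tables, not a literature fact.) -/
def IsRankOneQuad (P : (Fin k → Bool) → Bool) : Prop :=
  ∃ A B : (Fin k → Bool) → Bool, ∃ c : Bool, IsAffinePred A ∧ IsAffinePred B ∧ ∀ u, P u = (c ^^ (A u && B u))

/-- The chosen first affine factor. -/
noncomputable def factA (P : (Fin k → Bool) → Bool) (h : IsRankOneQuad P) : (Fin k → Bool) → Bool := Classical.choose h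

/-- The chosen second affine factor. -/
noncomputable def factB (P : (Fin k → Bool) → Bool) (h : IsRankOneQuad P) : (Fin k → Bool) → Bool :=
  Classical.choose (Classical.choose_spec h)

/-- The chosen outer constant. -/
noncomputable def outerC (P : (Fin k → Bool) → Bool) (h : IsRankOneQuad P) : Bool :=
  Classical.choose (Classical.choose_spec (Classical.choose_spec h))

/-- The chosen decomposition `P = c ⊕ (A ∧ B)`. -/
theorem fact_spec (P : (Fin k → Bool) → Bool) (h : IsRankOneQuad P) :
    IsAffinePred (factA P h) ∧ IsAffinePred (factB P h) ∧ ∀ u, P u = (outerC P h ^^ (factA P h u && factB P h u)) :=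
  Classical.choose_spec (Classical.choose_spec (Classical.choose_spec h))

/-- Per-table record: `((support of A, A 0), (support of B, B 0), c)`. -/
abbrev RRec : Type := (List ℕ × Bool) × (List ℕ × Bool) × Bool

open Classical in
/-- RANK-ONE DATA of a table: the affine data (`AffineSplitFP.affData`: support positions, constant bit) of the
two chosen factors and the outer constant; junk for tables outside the class.  (Noncomputable CHOICE; for fixed
`k` a finite table hard-coded in the machine.) -/
noncomputable def r1Data (P : (Fin k → Bool) → Bool) : RRec :=
  if h : IsRankOneQuad P then ((affData (factA P h)).2, (affData (factB P h)).2, outerC P h)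
  else (([], false), ([], false), false)

/-- Rank-one data of a table in the class. -/
theorem r1Data_of (P : (Fin k → Bool) → Bool) (h : IsRankOneQuad P) :
    r1Data P = ((affData (factA P h)).2, (affData (factB P h)).2, outerC P h) := by
  unfold r1Data; rw [dif_pos h]

/-- The rank-one data READ OFF A TABLE BLOCK (junk blocks ↦ junk; a FINITE lookup for the typing). -/
noncomputable def r1Row (k : ℕ) (tab : List Bool) : RRec :=
  if tab ∈ allBits (2 ^ k) then r1Data (tableOfBits k tab) else (([], false), ([], false), false)

/-- On the table block of output `j` the lookup returns the rank-one data of its table. -/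
theorem r1Row_tabOf (I : LocalMap k n m) (j : Fin m) : r1Row k (tabOf I j) = r1Data (I.table j) := by
  unfold r1Row
  rw [if_pos (mem_allBits.2 (length_tabOf I j)), tableOfBits_tabOf]

/-! ## The program -/

/-- Classifying one decoded output: support positions replaced by the positions READ there (the two `𝔽₂`-rows
`Σ_{i ∈ S} e_{v_i}` as index lists), the three constant bits kept. -/
noncomputable def rcls (k : ℕ) (o : List Bool × List ℕ) : RRec :=
  (((r1Row k o.1).1.1.map fun i => o.2.getD i 0, (r1Row k o.1).1.2),
    ((r1Row k o.1).2.1.1.map fun i => o.2.getD i 0, (r1Row k o.1).2.1.2), (r1Row k o.1).2.2)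

/-- All outputs, classified. -/
noncomputable def rrecs (k : ℕ) (outs : List (List Bool × List ℕ)) : List RRec := outs.map (rcls k)

/-- The AUGMENTED row of an affine condition «form `= 1`» over `N + 1` coordinates: the row, with the extra
coordinate `N` present iff the right-hand side `1 + (constant bit)` is `1`, i.e. iff the constant bit is `0`. -/
def augOf (N : ℕ) (p : List ℕ × Bool) : List ℕ := if p.2 then p.1 else p.1 ++ [N]

/-- The augmented rows of the system «`A_j = 1`, `B_j = 1` for all `j`». -/
def augRows (N : ℕ) (rs : List RRec) : List (List ℕ) := (rs.map fun r => [augOf N r.1, augOf N r.2.1]).flatten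

/-- INCONSISTENCY of that system: `e_N` lies in the span of the augmented rows (one span test). -/
def incons (N : ℕ) (rs : List RRec) : Bool := inSpan (N + 1) (augRows N rs) [N]

/-- The records, indexed. -/
def tagged (rs : List RRec) : List (ℕ × RRec) := rs.mapIdx Prod.mk

/-- The rows (both factors) of all outputs OTHER than `i`. -/
def others (rs : List RRec) (i : ℕ) : List (List ℕ) :=
  (((tagged rs).filter fun t => !(t.1 == i)).map fun t => [t.2.1.1, t.2.2.1.1]).flatten

/-- Output `i` is GOOD: both its rows lie in the span of the other outputs' rows (two span tests). -/
def good (N : ℕ) (rs : List RRec) (t : ℕ × RRec) : Bool :=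
  inSpan N (others rs t.1) t.2.1.1 && inSpan N (others rs t.1) t.2.2.1.1

/-- The first good output (`= |rs|` if none). -/
def iStar (N : ℕ) (rs : List RRec) : ℕ := (tagged rs).findIdx (good N rs)

/-- The printed bits: `¬c_j`, flipped at the good output when the system is consistent. -/
def outR (N : ℕ) (rs : List RRec) : List Bool :=
  rs.mapIdx fun j r => !r.2.2 ^^ (!incons N rs && (j == iStar N rs))

/-- **THE MACHINE** `r1Str k`: decode, classify, test, print. -/
noncomputable def r1Str (k : ℕ) (w : List Bool) : List Bool := outR (hdrN w) (rrecs k (decode k w))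

/-! ## Semantics on the code of an instance -/

/-- First row of output `j` (index list of the positions read at the support of `A_j`). -/
noncomputable def L1 (I : LocalMap k n m) (j : Fin m) : List ℕ := (r1Data (I.table j)).1.1.map fun i => (rowOf I j).getD i 0

/-- Constant bit of `A_j`. -/
noncomputable def b1 (I : LocalMap k n m) (j : Fin m) : Bool := (r1Data (I.table j)).1.2

/-- Second row of output `j`. -/
noncomputable def L2 (I : LocalMap k n m) (j : Fin m) : List ℕ := (r1Data (I.table j)).2.1.1.map fun i => (rowOf I j).getD i 0

/-- Constant bit of `B_j`. -/
noncomputable def b2 (I : LocalMap k n m) (j : Fin m) : Bool := (r1Data (I.table j)).2.1.2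

/-- Outer constant of output `j`. -/
noncomputable def cc (I : LocalMap k n m) (j : Fin m) : Bool := (r1Data (I.table j)).2.2

/-- The record of output `j`. -/
noncomputable def rrecOf (I : LocalMap k n m) (j : Fin m) : RRec := ((L1 I j, b1 I j), (L2 I j, b2 I j), cc I j)

/-- The records of an instance. -/
noncomputable def recsOf (I : LocalMap k n m) : List RRec := (List.finRange m).map (rrecOf I)

/-- Classifying the decoded output `j`. -/
theorem rcls_out (I : LocalMap k n m) (j : Fin m) : rcls k (tabOf I j, rowOf I j) = rrecOf I j := by
  unfold rcls rrecOf L1 b1 L2 b2 cc; rw [r1Row_tabOf]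

/-- **The records of a genuine code.** -/
theorem rrecs_outsOf (I : LocalMap k n m) : rrecs k (outsOf I) = recsOf I := by
  unfold rrecs outsOf recsOf
  rw [List.map_map]
  exact List.map_congr_left fun j _ => rcls_out I j

/-- The indexed records of a genuine code. -/
theorem tagged_recsOf (I : LocalMap k n m) : tagged (recsOf I) = (List.finRange m).map fun j => (j.val, rrecOf I j) := by
  unfold tagged recsOf; rw [mapIdx_map_finRange]

/-- The other outputs' rows, on a genuine code: both rows of every output `j ≠ i`, in order. -/
theorem others_recsOf (I : LocalMap k n m) (i : Fin m) :
    others (recsOf I) i.val = (((List.finRange m).filter fun j => !(j.val == i.val)).map fun j => [L1 I j, L2 I j]).flatten := by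
  unfold others
  rw [tagged_recsOf, List.filter_map, List.map_map]
  rfl

/-- **What the machine prints on a genuine code**: at output `j`, `¬c_j`, flipped iff the system is consistent
and `j` is the first good output. -/
theorem readOut_r1Str (I : LocalMap k n m) (j : Fin m) :
    readOut m (r1Str k I.encode) j = (!cc I j ^^ (!incons n (recsOf I) && (j.val == iStar n (recsOf I)))) := by
  unfold readOut r1Str
  rw [decode_encode, hdrN_encode, rrecs_outsOf, outR, recsOf, mapIdx_map_finRange, getD_map_finRange]
  rfl

end Summit.PneNP.PneNP.Theorems.RankOneQuadAvoidFP
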